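import Summits.QuantumFields.YangMills.Theorems.BalabanUVNodesN22KernelLimitOfRealTwoPoint

/-!
# NODE N22 (NE9) — THE (1.21)-EXISTENCE HALF KEYED ON THE CHART-FREE REAL-PROBE LAW (G≈ℝ): (G≈ℝ) ⟹ (S≈) in the towers, and W1-19b's letters `PolLimitsExist` ∕
# `PolLimitsExistOfRecord₁₃` from W1's activity-level value slot + the real-probe cross-volume law (sequel to `…N22KernelLimitOfRealTwoPoint`)

Cell `pub-ymgap`, Track A (HUMAN RULING D-0062), WIDTH SEAT `dag-n22-w3` g4 on node n22 = NE9; `--kind proof --supports stmt-QuantumFields-20544 --as helper` (K3⁷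
`SpineGivenEndpointR13SepCoPH`, skeleton v5 941dddb108cbaacf), COUNT-NEUTRAL.  Second file of CLAIM-3 of this seat (pub-ymgap INBOX l.32110; split for the 400-line rule) over the generic
half `…N22KernelLimitOfRealTwoPoint` (§1 `norm_le_twoConstants_bidisc` ∕ `sum_exp_neg_torusTreeLen_filter_le`, §2 `twoConstantsLetter_mono` ∕ `twoConstantsLetter_geometric` ∕
`abs_avg_polTensor_twoPoint_sub_le_of_realFlat`).

* §3 `domCount_le_sitesPerDir` ∕ `domCount_pow_four_le` (cubes per direction of `𝐃_j` on the `K`-th torus `≤ 2L^{m+K}`, so `(cubes)⁴ ≤ 16L^{4m}(L⁴)^K`); ★★ `approxStable_of_realTwoPoint` —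
  (G≈ℝ) «for `g ∈ W`, `k`, `(μ, ν, z)`: from a threshold on, every colour `c`, all REAL `|a|,|b| ≤ r₂`: `‖Σ_{X ∈ lo k (K+1)} E^{(k+1)}_X(hist; emb_{K+1}(exp ρ(a·e_{μ,z,c} + b·e_{ν,0,c}))) −
  Σ_{X ∈ lo k K} E^{(k+1)}_X(hist; emb_K(exp ρ(a·e_{μ,z,c} + b·e_{ν,0,c})))‖ ≤ C r₀^K`» (`0 < r₀ ≤ 1`; the FINITE-VOLUME (2.13) terms at Bałaban's real probe families — [I] p. 264 «we take a
  limit of these functions as T^{(j+1)} ↗ Z^d» — NO complexification in the law) ⟹ (S≈) VERBATIM (the `hS` binder of p607522 ∕ p611742) at the rate `ρ_s = (r₀^{1−s}(L⁴)^{s})^{1−s}(L⁴)^{s}`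
  for every `s ∈ ]0,1[`, under the activity-slot road's own inputs: the two-point complex generating functions are holomorphic on the bidisc `‖σ‖ < 2r₂` (p615597 §1), bounded there by
  `Q·(cubes)⁴`, `Q = e·9·64·K₀(64,8)²·A·K₀(4·2⁴,8)` (J30-v1.1's VALUE half summed by the torus count), their real restrictions ARE the chart-free sums (chart clause `Φ(ιc B) = emb(exp ρB)`),
  and the generic half's two-constants ∕ Cauchy ∕ algebra lemmas conclude.
* §4 ★★★ `polLimitsExist_localizedSum_of_realTwoPoint` — p607522 §1 (W1-19b's `PolLimitsExist F (localizedSum F S emb) ρ bV W`) with the structural law (S≈) REPLACED by (G≈ℝ) + the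
  numeral `ρ_s < 1` (one application of §3).  v1.1 erratum (docstring-only; every declaration byte-identical): the RECORD edition ★★★ `polLimitsExistOfRecord₁₃_of_realTwoPoint`
  (p607522 §2 likewise), the (G≈ℝ)-keyed row sentences of p611742, `exists_realTwoPoint_dials` and the A6 termless-tower witness are typed in the sequel `…N22KernelLimitOfRealTwoPointRecord`
  (p620925), NOT in this file — THIS file ends at §4 with four theorems.

HONEST FRAMING (binding).  Count-neutral helper; THEOREMS ONLY (0 def, 0 sorry, standard axioms).  (G≈ℝ) is a DISPLAYED HYPOTHESIS with its owner (NODE A ∕ def-W1: thermodynamic convergence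
near the window of the finite-volume local terms — (1.7)-locality + the p. 282 tails; NOT typed here), as are W1's (2.38) value slot at the towers of record (N10 ∕ NODE A), activity
holomorphy through the complexified minimizer reading and the reading itself ([I] p. 264, [II] p. 15 — NODE A), the p. 282 site-weight tails, W1-20's law `Localizes17OfRecord₁₃` (NODE A ∕
N10), Road-1 numerals and the rate numeral `ρ_s < 1`.  (1.21)'s existence for the terms OF RECORD is NOT proved; nothing of Bałaban's is constructed or asserted; no inhabitant at the datum
of record; N22 NOT discharged (typed 28∕28 · discharged 5∕27 UNMOVED); K3⁷ OPEN, NOT claimed; no count claim (the chair's single count line is the only count); one finite 𝕋⁴ programme at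
fixed ε — R4 closes the CONDITIONAL rung `BalabanLadder.UV` only; NOTHING about the continuum limit, ℝ⁴, infinite volume, OS axioms, a mass gap or the Clay problem is proved or claimed by
any of this.  No decl carries a cite tag (Summit side); TYPES only: [I] = [Balaban1987RG1] (1.7) p. 261, (1.20)–(1.21) p. 264, p. 282; [II] = [Balaban1988RG2Cluster] (1.26) p. 8, (2.13)–(2.14)
pp. 14–15, (2.38) p. 20.
-/

noncomputable section

open Filter Topology Metric Set
open scoped BigOperators

namespace YMDAG.N22.AtKernels

open Literature.MathematicalPhysics.QuantumFieldTheory.Balaban1983to89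
open Literature.MathematicalPhysics.QuantumFieldTheory.Balaban1983to89.B12PolarizationTensor120 (polTensor polComp expChart)
open Literature.MathematicalPhysics.QuantumFieldTheory.Balaban1983to89.B12TreeDecay (K₀ kappa₀ K₀_pos kappa₀_nonneg)
open Literature.MathematicalPhysics.QuantumFieldTheory.Balaban1983to89.TreeLengthTorus (TPt torusTreeLen torusTreeLen_nonneg tsys tcubeSys)
open Literature.MathematicalPhysics.QuantumFieldTheory.Balaban1983to89.T4Continuum (T4Family)
open Literature.MathematicalPhysics.QuantumFieldTheory.Balaban1983to89.T4OutputRate (Window)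
open Literature.MathematicalPhysics.QuantumFieldTheory.Balaban1983to89.Node00 (polScalar polWindow siteOfInt PolLimitExists Stage13Params MatA)
open Literature.MathematicalPhysics.QuantumFieldTheory.Balaban1983to89.Node00.Sect2 (domCount domSys CPair)
open Literature.MathematicalPhysics.QuantumFieldTheory.Balaban1983to89.B14.Eq213MaximalDomains (side)
open Literature.MathematicalPhysics.QuantumFieldTheory.Balaban1983to89.Node00.W1 (ClusterTower ClusterStep)
open Literature.MathematicalPhysics.QuantumFieldTheory.Balaban1983to89.Node00.LocalizedSum17 (localizedSum ReadingMaps Localizes17OfRecord₁₃)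
open Literature.MathematicalPhysics.QuantumFieldTheory.Balaban1983to89.Node00.U3OfKernels (histPrefix)
open Literature.MathematicalPhysics.QuantumFieldTheory.Balaban1983to89.Node00.U3KernelLetters (PolLimitsExist PolLimitsExistOfRecord₁₃ polLimitsExistOfRecord₁₃_iff_of_localizes)
open Literature.MathematicalPhysics.QuantumFieldTheory.Balaban1983to89.B12Decay510Torus (distCT nearT distCT_nonneg)
open YMDAG.N22.WindowOfLocalTerms (differentiableOn_and_norm_clusterStepE_comp_le_of_activityHol)

/-! ## §3 In the towers: the CHART-FREE REAL-PROBE law (G≈ℝ) gives the kernel-level law (S≈) of p607522 ∕ p611742 VERBATIM -/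

section Towers

variable {𝔄 : Type*} [NormedRing 𝔄] [NormedAlgebra ℝ 𝔄] {𝔸 : Type*}
variable {V : Type*} [NormedAddCommGroup V] [NormedSpace ℝ V] {ι : Type*} [Fintype ι]
variable (F : T4Family)

/-- The cube count per direction of `𝐃_j` on the `K`-th torus is at most the number of fine sites per direction `2L^{m+K}` (a successor of a quotient of `2L^{m+K} − 1`).
[cite: Balaban1987RG1, p.257 (the cubes π_j; bookkeeping)] -/
theorem domCount_le_sitesPerDir (K M j : ℕ) : domCount (F.P K) M j ≤ (F.P K).sitesPerDir 0 := by
  have h1 : 1 ≤ (F.P K).sitesPerDir 0 := by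
    rw [T4Family.sitesPerDir_eq]; have := Nat.one_le_pow (F.m + K) F.L (by have := F.hL.2; omega); omega
  have h2 := Nat.div_le_self ((F.P K).sitesPerDir 0 - 1) (side (F.P K).L M j)
  show ((F.P K).sitesPerDir 0 - 1) / side (F.P K).L M j + 1 ≤ (F.P K).sitesPerDir 0
  omega

/-- … hence `(cube count)^4 ≤ 16·L^{4m}·(L⁴)^K`. [cite: Balaban1987RG1, p.257 (bookkeeping)] -/
theorem domCount_pow_four_le (K M j : ℕ) :
    ((domCount (F.P K) M j : ℕ) : ℝ) ^ 4 ≤ 16 * (F.L : ℝ) ^ (4 * F.m) * ((F.L : ℝ) ^ 4) ^ K := by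
  have h := domCount_le_sitesPerDir F K M j
  rw [T4Family.sitesPerDir_eq] at h
  have hc : ((domCount (F.P K) M j : ℕ) : ℝ) ≤ 2 * (F.L : ℝ) ^ (F.m + K) := by exact_mod_cast h
  calc ((domCount (F.P K) M j : ℕ) : ℝ) ^ 4 ≤ (2 * (F.L : ℝ) ^ (F.m + K)) ^ 4 := pow_le_pow_left₀ (Nat.cast_nonneg _) hc 4
    _ = 16 * (F.L : ℝ) ^ (4 * F.m) * ((F.L : ℝ) ^ 4) ^ K := by ring

open Classical in
/-- ★★ **(G≈ℝ) ⟹ (S≈): THE KERNEL-LEVEL CROSS-VOLUME LAW FROM THE CHART-FREE REAL-PROBE LAW.**  In the setting of `approxStable_of_twoPointGenerating` (towers `S`, reading maps `emb`, probe `ρ`,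
basis `bV`, window `W`; W1's (2.38) value slot on prefix sets with Road-1 numerals `0 ≤ A`, `0 ≤ r₁`, `0 < κ ≤ r₁`, `κ₀(64,8) ≤ κ∕4`, `r₁ + 128 log 162 + 2 ≤ R`, `A e^{5r₁+1}K₀(64,8)·9·64 ≤ 1`;
per-term complexified readings `Φ K k X` on open `U K k X ⊇ ball 0 r` through `ιc K k X` with the chart clause, the space clause and activity holomorphy; site weights `≤ B₃ e^{−δ₀ dist}`; a
small∕near class `lo k K`), IF (G≈ℝ): for every `g ∈ W`, `k`, `(μ, ν, z)` there are `K₀, C` with, for all `K ≥ K₀`, all colours `c` and all REAL `|a|, |b| ≤ r₂` (`0 < r₂`, `(2B₃+1)·2r₂ ≤ r`),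
`‖Σ_{X ∈ lo k (K+1)} E^{(k+1)}_X(hist; emb_{K+1}(exp ρ(a·e_{μ,z,c} + b·e_{ν,0,c}))) − Σ_{X ∈ lo k K} E^{(k+1)}_X(hist; emb_K(exp ρ(a·e_{μ,z,c} + b·e_{ν,0,c})))‖ ≤ C r₀^K` (`0 < r₀ ≤ 1`) — the
FINITE-VOLUME (2.13) terms at Bałaban's own real probe families, NO complexification — THEN (S≈) holds at the rate `ρ_s = (r₀^{1−s}(L⁴)^{s})^{1−s}(L⁴)^{s}` for every `s ∈ ]0, 1[`.
ROUTE: the two-point complex generating functions are holomorphic on the bidisc `‖σ‖ < 2r₂` (schema §1) and bounded there by `e·9·64·K₀(64,8)²·A·K₀(4·2⁴,8)·(cubes)⁴ ≤ M₀(L⁴)^K`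
(J30-v1.1's VALUE half summed by the torus count `sum_exp_neg_torusTreeLen_filter_le`); their real restrictions are the chart-free sums of (G≈ℝ) (chart clause `Φ(ιc B) = emb(exp ρB)`); the
two-variable two-constants bound §1 and J28's Cauchy bound (§2) give the kernel difference; §2's algebra makes it geometric.
[cite: Balaban1987RG1, (1.7) p.261, (1.20)-(1.21) p.264; Balaban1988RG2Cluster, (1.26) p.8, (2.13)-(2.14) pp.14-15, (2.38) p.20] -/
theorem approxStable_of_realTwoPoint (M : ℕ) [NeZero M]
    (S : (K : ℕ) → ClusterTower (F.P K) 𝔸 M) (emb : ReadingMaps F 𝔄 𝔸) (ρ : V →L[ℝ] 𝔄) (bV : Module.Basis ι ℝ V) (W : Set (ℕ → ℝ))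
    (Wk : (K k : ℕ) → Set (Fin (k + 1) → ℝ)) (hWk : ∀ g ∈ W, ∀ K k, histPrefix g k ∈ Wk K k)
    (sp : (K k : ℕ) → (domSys (F.P K) M (k + 1)).Dom → Set (CPair (F.P K) 𝔸)) {A R r₁ κ B₃ δ₀ r r₂ r₀ s : ℝ}
    (hA : 0 ≤ A) (hr₁ : 0 ≤ r₁) (hκ0 : 0 < κ) (hκ : κ ≤ r₁) (hκ4 : kappa₀ (4 * 2 ^ 4) (2 * 4) ≤ κ / 2 / 2) (hrate : r₁ + 2 * (64 * Real.log 162) + 2 ≤ R)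
    (hsmall : A * Real.exp (5 * r₁ + 1) * K₀ 64 8 * 9 * 64 ≤ 1) (hB₃ : 0 ≤ B₃) (hδ₀ : 0 < δ₀) (hr : 0 < r)
    (h238 : ∀ K k, ((S K) k).Bound238 (Wk K k) (sp K k) A R)
    (Ec : ℕ → ℕ → Type*) [∀ K k, NormedAddCommGroup (Ec K k)] [∀ K k, NormedSpace ℂ (Ec K k)]
    (ιc : (K k : ℕ) → (domSys (F.P K) M (k + 1)).Dom → ((Fin (F.P K).d → Site (F.P K) (k + 1) → V) →L[ℝ] Ec K k))
    (Φ : (K k : ℕ) → (domSys (F.P K) M (k + 1)).Dom → Ec K k → CPair (F.P K) 𝔸)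
    (U : (K k : ℕ) → (domSys (F.P K) M (k + 1)).Dom → Set (Ec K k)) (hU : ∀ K k X, IsOpen (U K k X)) (hrU : ∀ K k X, ball (0 : Ec K k) r ⊆ U K k X)
    (hHhol : ∀ K k, ∀ hist ∈ Wk K k, ∀ (X Z : (domSys (F.P K) M (k + 1)).Dom), Z.1 ⊆ X.1 →
      DifferentiableOn ℂ (fun z => ((S K) k).H hist (Φ K k X z) Z) (U K k X))
    (hΦemb : ∀ K k X (B : Fin (F.P K).d → Site (F.P K) (k + 1) → V), Φ K k X (ιc K k X B) = emb K k (fun l t => NormedSpace.exp (ρ (B l t))))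
    (hΦsp : ∀ K k X, ∀ z ∈ U K k X, ∀ Z : (domSys (F.P K) M (k + 1)).Dom, Z.1 ⊆ X.1 → Φ K k X z ∈ sp K k Z)
    (w : (K k : ℕ) → (domSys (F.P K) M (k + 1)).Dom → Site (F.P K) (k + 1) → ℝ)
    (hw : ∀ K k X (l : Fin (F.P K).d) (t : Site (F.P K) (k + 1)) (c : ι), ‖ιc K k X (Pi.single l (Pi.single t (bV c)))‖ ≤ w K k X t)
    (hwB : ∀ K k (X : (domSys (F.P K) M (k + 1)).Dom) (t : Site (F.P K) (k + 1)),
      w K k X t ≤ B₃ * Real.exp (-δ₀ * distCT (domCount (F.P K) M (k + 1)) M (fun i => (ZMod.cast (t i) : ZMod (domCount (F.P K) M (k + 1) * M)))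
        (nearT (M := M) (fun i => (ZMod.cast (t i) : ZMod (domCount (F.P K) M (k + 1) * M))) X)))
    (lo : (k K : ℕ) → (domSys (F.P K) M (k + 1)).Dom → Prop) [∀ k K, DecidablePred (lo k K)]
    (hr₂ : 0 < r₂) (hr₂r : (2 * B₃ + 1) * (2 * r₂) ≤ r) (hs0 : 0 < s) (hs1 : s < 1) (hr₀pos : 0 < r₀) (hr₀1 : r₀ ≤ 1)
    (hGR : ∀ g ∈ W, ∀ (k : ℕ) (μ ν : Fin 4) (z : Fin 4 → ℤ), ∃ (K₀ : ℕ) (C : ℝ), ∀ K : ℕ, K₀ ≤ K → ∀ (c : ι) (a b : ℝ), |a| ≤ r₂ → |b| ≤ r₂ →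
      ‖∑ X ∈ Finset.univ.filter (lo k (K + 1)), ((S (K + 1)) k).E (histPrefix g k) (emb (K + 1) k (fun l t => NormedSpace.exp (ρ
          ((a • (Pi.single (Fin.cast (F.P_d (K + 1)).symm μ) (Pi.single (siteOfInt F (K + 1) (k + 1) z) (bV c)) : Fin (F.P (K + 1)).d → Site (F.P (K + 1)) (k + 1) → V) +
            b • (Pi.single (Fin.cast (F.P_d (K + 1)).symm ν) (Pi.single (siteOfInt F (K + 1) (k + 1) 0) (bV c)) : Fin (F.P (K + 1)).d → Site (F.P (K + 1)) (k + 1) → V)) l t)))) X -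
        ∑ X ∈ Finset.univ.filter (lo k K), ((S K) k).E (histPrefix g k) (emb K k (fun l t => NormedSpace.exp (ρ
          ((a • (Pi.single (Fin.cast (F.P_d K).symm μ) (Pi.single (siteOfInt F K (k + 1) z) (bV c)) : Fin (F.P K).d → Site (F.P K) (k + 1) → V) +
            b • (Pi.single (Fin.cast (F.P_d K).symm ν) (Pi.single (siteOfInt F K (k + 1) 0) (bV c)) : Fin (F.P K).d → Site (F.P K) (k + 1) → V)) l t)))) X‖ ≤ C * r₀ ^ K) :
    ∀ g ∈ W, ∀ (k : ℕ) (μ ν : Fin 4) (z : Fin 4 → ℤ), ∃ (K₀ : ℕ) (C : ℝ), ∀ K : ℕ, K₀ ≤ K →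
      |∑ X ∈ Finset.univ.filter (lo k (K + 1)), polScalar (fun U' => (((S (K + 1)) k).E (histPrefix g k) (emb (K + 1) k U') X).re) ρ bV (Fin.cast (F.P_d (K + 1)).symm μ) (siteOfInt F (K + 1) (k + 1) z) (Fin.cast (F.P_d (K + 1)).symm ν) (siteOfInt F (K + 1) (k + 1) 0) -
        ∑ X ∈ Finset.univ.filter (lo k K), polScalar (fun U' => (((S K) k).E (histPrefix g k) (emb K k U') X).re) ρ bV (Fin.cast (F.P_d K).symm μ) (siteOfInt F K (k + 1) z) (Fin.cast (F.P_d K).symm ν) (siteOfInt F K (k + 1) 0)| ≤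
        C * ((r₀ ^ (1 - s) * ((F.L : ℝ) ^ 4) ^ s) ^ (1 - s) * ((F.L : ℝ) ^ 4) ^ s) ^ K := by
  intro g hg k μ ν z
  obtain ⟨N₀, C, hC⟩ := hGR g hg k μ ν z
  -- the letters
  set C₁ : ℝ := max C 0 + 1 with hC₁
  have hC₁0 : 0 < C₁ := by rw [hC₁]; positivity
  set Q : ℝ := Real.exp 1 * 9 * 64 * K₀ 64 8 ^ 2 * A * K₀ (4 * 2 ^ 4) (2 * 4) with hQ
  have hQ0 : 0 ≤ Q := by rw [hQ]; have := K₀_pos (4 * 2 ^ 4 : ℝ) (2 * 4); positivity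
  set μL : ℝ := (F.L : ℝ) ^ 4 with hμL
  have hL1 : (1 : ℝ) ≤ F.L := by exact_mod_cast F.hL.2.le
  have hμ1 : 1 ≤ μL := one_le_pow₀ hL1
  have hμ0 : 0 ≤ μL := zero_le_one.trans hμ1
  set D₀ : ℝ := 16 * (F.L : ℝ) ^ (4 * F.m) with hD₀
  have hD₀0 : 0 ≤ D₀ := by rw [hD₀]; positivity
  set M₂ : ℝ := Q * D₀ * μL + Q * D₀ + C₁ with hM₂
  have hM₂0 : 0 ≤ M₂ := by rw [hM₂]; positivity
  clear_value C₁ Q μL D₀ M₂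
  refine ⟨N₀, 16 * ((C₁ ^ (1 - s) * M₂ ^ s) ^ (1 - s) * M₂ ^ s) / (r₂ * s / 4) ^ 2, fun K hK => ?_⟩
  have hκr₁ : kappa₀ (4 * 2 ^ 4) (2 * 4) ≤ r₁ := by
    have h4 : κ / 2 / 2 ≤ κ := by rw [div_div]; exact div_le_self hκ0.le (by norm_num)
    exact hκ4.trans (h4.trans hκ)
  have hr₂r' : (2 * B₃ + 1) * (2 * r₂) ≤ r := hr₂r
  -- J30-v1.1's engine: every term, read through `Φ`, is holomorphic on `U` with the (2.38)-type value bound there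
  have key := fun (K' : ℕ) (X : (domSys (F.P K') M (k + 1)).Dom) =>
    differentiableOn_and_norm_clusterStepE_comp_le_of_activityHol F K' ((S K') k) (Wk K' k) (sp K' k) hA hr₁ hrate hsmall (h238 K' k) (hWk g hg K' k) X
      (Φ K' k X) (hU K' k X) (hHhol K' k _ (hWk g hg K' k) X) (hΦsp K' k X)
  have hf : ∀ (K' : ℕ) (X : (domSys (F.P K') M (k + 1)).Dom) (B : Fin (F.P K').d → Site (F.P K') (k + 1) → V),
      expChart (fun U' => (((S K') k).E (histPrefix g k) (emb K' k U') X).re) ρ B = (((S K') k).E (histPrefix g k) (Φ K' k X (ιc K' k X B)) X).re :=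
    fun K' X B => by rw [B12PolarizationTensor120.expChart_apply, hΦemb]
  have h0U : ∀ (K' : ℕ) (X : (domSys (F.P K') M (k + 1)).Dom), (0 : Ec K' k) ∈ U K' k X := fun K' X => hrU K' k X (mem_ball_self hr)
  have hιB : ∀ (K' : ℕ) (X : (domSys (F.P K') M (k + 1)).Dom) (l : Fin (F.P K').d) (t : Site (F.P K') (k + 1)) (c : ι),
      ‖ιc K' k X (Pi.single l (Pi.single t (bV c)))‖ ≤ B₃ := fun K' X l t c => by
    refine (hw K' k X l t c).trans ((hwB K' k X t).trans (mul_le_of_le_one_right hB₃ (Real.exp_le_one_iff.2 ?_)))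
    exact mul_nonpos_of_nonpos_of_nonneg (neg_nonpos.2 hδ₀.le) (distCT_nonneg _ _)
  -- a point of the closed bidisc of radius `r₂` reads a point of `ball 0 r ⊆ U`
  have hpt : ∀ (K' : ℕ) (X : (domSys (F.P K') M (k + 1)).Dom) (a b : Ec K' k), ‖a‖ ≤ B₃ → ‖b‖ ≤ B₃ → ∀ σ : Fin 2 → ℂ, ‖σ‖ ≤ r₂ →
      σ 0 • a + σ 1 • b ∈ U K' k X := by
    intro K' X a b ha hb σ hσ
    refine hrU K' k X (mem_ball_zero_iff.2 ?_)
    have h0 : ‖σ 0‖ ≤ r₂ := (norm_le_pi_norm σ 0).trans hσ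
    have h1 : ‖σ 1‖ ≤ r₂ := (norm_le_pi_norm σ 1).trans hσ
    calc ‖σ 0 • a + σ 1 • b‖ ≤ ‖σ 0‖ * ‖a‖ + ‖σ 1‖ * ‖b‖ := (norm_add_le _ _).trans (by rw [norm_smul, norm_smul])
      _ ≤ r₂ * B₃ + r₂ * B₃ := add_le_add (mul_le_mul h0 ha (norm_nonneg _) hr₂.le) (mul_le_mul h1 hb (norm_nonneg _) hr₂.le)
      _ < r := by
          have e : (2 * B₃ + 1) * (2 * r₂) = 4 * (r₂ * B₃) + 2 * r₂ := by ring
          nlinarith [mul_nonneg hr₂.le hB₃]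
  -- the per-volume sup bound on the closed bidisc: `Q · (cubes)^4 ≤ Q · D₀ · μ^K'`
  have hsup : ∀ (K' : ℕ) (c : ι) (σ : Fin 2 → ℂ), ‖σ‖ ≤ r₂ →
      ‖∑ X ∈ Finset.univ.filter (lo k K'), ((S K') k).E (histPrefix g k) (Φ K' k X
          (σ 0 • ιc K' k X (Pi.single (Fin.cast (F.P_d K').symm μ) (Pi.single (siteOfInt F K' (k + 1) z) (bV c))) +
           σ 1 • ιc K' k X (Pi.single (Fin.cast (F.P_d K').symm ν) (Pi.single (siteOfInt F K' (k + 1) 0) (bV c))))) X‖ ≤ Q * D₀ * μL ^ K' := by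
    intro K' c σ hσ
    have hterm : ∀ X ∈ Finset.univ.filter (lo k K'), ‖((S K') k).E (histPrefix g k) (Φ K' k X
          (σ 0 • ιc K' k X (Pi.single (Fin.cast (F.P_d K').symm μ) (Pi.single (siteOfInt F K' (k + 1) z) (bV c))) +
           σ 1 • ιc K' k X (Pi.single (Fin.cast (F.P_d K').symm ν) (Pi.single (siteOfInt F K' (k + 1) 0) (bV c))))) X‖ ≤
        Real.exp 1 * 9 * 64 * K₀ 64 8 ^ 2 * A * Real.exp (-(r₁ * torusTreeLen X.1)) :=
      fun X _ => (key K' X).2 _ (hpt K' X _ _ (hιB K' X _ _ c) (hιB K' X _ _ c) σ hσ)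
    have hE0 : 0 ≤ Real.exp 1 * 9 * 64 * K₀ 64 8 ^ 2 * A := by positivity
    calc _ ≤ ∑ X ∈ Finset.univ.filter (lo k K'), Real.exp 1 * 9 * 64 * K₀ 64 8 ^ 2 * A * Real.exp (-(r₁ * torusTreeLen X.1)) :=
          (norm_sum_le _ _).trans (Finset.sum_le_sum hterm)
      _ = Real.exp 1 * 9 * 64 * K₀ 64 8 ^ 2 * A * ∑ X ∈ Finset.univ.filter (lo k K'), Real.exp (-(r₁ * torusTreeLen X.1)) := by
          rw [Finset.mul_sum]
      _ ≤ Real.exp 1 * 9 * 64 * K₀ 64 8 ^ 2 * A * (((domCount (F.P K') M (k + 1) : ℕ) : ℝ) ^ 4 * K₀ (4 * 2 ^ 4) (2 * 4)) :=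
          mul_le_mul_of_nonneg_left (sum_exp_neg_torusTreeLen_filter_le (domCount (F.P K') M (k + 1)) hκr₁ (lo k K')) hE0
      _ = Q * ((domCount (F.P K') M (k + 1) : ℕ) : ℝ) ^ 4 := by rw [hQ]; ring
      _ ≤ Q * (D₀ * μL ^ K') := mul_le_mul_of_nonneg_left (by rw [hD₀, hμL]; exact domCount_pow_four_le F K' M (k + 1)) hQ0
      _ = Q * D₀ * μL ^ K' := by ring
  -- the two-point complex generating functions of the two volumes
  set gA : ι → (Fin 2 → ℂ) → ℂ := fun c σ => ∑ X ∈ Finset.univ.filter (lo k (K + 1)), ((S (K + 1)) k).E (histPrefix g k) (Φ (K + 1) k X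
      (σ 0 • ιc (K + 1) k X (Pi.single (Fin.cast (F.P_d (K + 1)).symm μ) (Pi.single (siteOfInt F (K + 1) (k + 1) z) (bV c))) +
       σ 1 • ιc (K + 1) k X (Pi.single (Fin.cast (F.P_d (K + 1)).symm ν) (Pi.single (siteOfInt F (K + 1) (k + 1) 0) (bV c))))) X with hgA
  set gB : ι → (Fin 2 → ℂ) → ℂ := fun c σ => ∑ X ∈ Finset.univ.filter (lo k K), ((S K) k).E (histPrefix g k) (Φ K k X
      (σ 0 • ιc K k X (Pi.single (Fin.cast (F.P_d K).symm μ) (Pi.single (siteOfInt F K (k + 1) z) (bV c))) +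
       σ 1 • ιc K k X (Pi.single (Fin.cast (F.P_d K).symm ν) (Pi.single (siteOfInt F K (k + 1) 0) (bV c))))) X with hgB
  have eA := sum_polScalar_eq_avg_polTensor_twoPointGenerating (Finset.univ.filter (lo k (K + 1)))
    (fun X U' => (((S (K + 1)) k).E (histPrefix g k) (emb (K + 1) k U') X).re) ρ bV (fun X z' => ((S (K + 1)) k).E (histPrefix g k) (Φ (K + 1) k X z') X)
    (fun X => U (K + 1) k X) (fun X => ιc (K + 1) k X) (fun X _ => hU (K + 1) k X) (fun X _ => h0U (K + 1) X) (fun X _ => (key (K + 1) X).1) (fun X _ B => hf (K + 1) X B)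
    (Fin.cast (F.P_d (K + 1)).symm μ) (siteOfInt F (K + 1) (k + 1) z) (Fin.cast (F.P_d (K + 1)).symm ν) (siteOfInt F (K + 1) (k + 1) 0) gA (fun c σ => by simp only [hgA])
  have eB := sum_polScalar_eq_avg_polTensor_twoPointGenerating (Finset.univ.filter (lo k K))
    (fun X U' => (((S K) k).E (histPrefix g k) (emb K k U') X).re) ρ bV (fun X z' => ((S K) k).E (histPrefix g k) (Φ K k X z') X)
    (fun X => U K k X) (fun X => ιc K k X) (fun X _ => hU K k X) (fun X _ => h0U K X) (fun X _ => (key K X).1) (fun X _ B => hf K X B)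
    (Fin.cast (F.P_d K).symm μ) (siteOfInt F K (k + 1) z) (Fin.cast (F.P_d K).symm ν) (siteOfInt F K (k + 1) 0) gB (fun c σ => by simp only [hgB])
  rw [eA, eB]
  have h2r₂ : 0 < 2 * r₂ := by linarith
  have hgAhol : ∀ c, DifferentiableOn ℂ (gA c) (ball 0 (2 * r₂)) := fun c => by
    simp only [hgA]
    exact differentiableOn_twoPointGenerating (Finset.univ.filter (lo k (K + 1))) (fun X z' => ((S (K + 1)) k).E (histPrefix g k) (Φ (K + 1) k X z') X)
      (fun X => U (K + 1) k X) (fun X => ιc (K + 1) k X (Pi.single (Fin.cast (F.P_d (K + 1)).symm μ) (Pi.single (siteOfInt F (K + 1) (k + 1) z) (bV c))))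
      (fun X => ιc (K + 1) k X (Pi.single (Fin.cast (F.P_d (K + 1)).symm ν) (Pi.single (siteOfInt F (K + 1) (k + 1) 0) (bV c))))
      hB₃ h2r₂ hr₂r' (fun X _ => hrU (K + 1) k X) (fun X _ => (key (K + 1) X).1) (fun X _ => hιB (K + 1) X _ _ c) (fun X _ => hιB (K + 1) X _ _ c)
  have hgBhol : ∀ c, DifferentiableOn ℂ (gB c) (ball 0 (2 * r₂)) := fun c => by
    simp only [hgB]
    exact differentiableOn_twoPointGenerating (Finset.univ.filter (lo k K)) (fun X z' => ((S K) k).E (histPrefix g k) (Φ K k X z') X)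
      (fun X => U K k X) (fun X => ιc K k X (Pi.single (Fin.cast (F.P_d K).symm μ) (Pi.single (siteOfInt F K (k + 1) z) (bV c))))
      (fun X => ιc K k X (Pi.single (Fin.cast (F.P_d K).symm ν) (Pi.single (siteOfInt F K (k + 1) 0) (bV c))))
      hB₃ h2r₂ hr₂r' (fun X _ => hrU K k X) (fun X _ => (key K X).1) (fun X _ => hιB K X _ _ c) (fun X _ => hιB K X _ _ c)
  -- the letters of the two-constants bound at this `K`
  set ε : ℝ := C₁ * r₀ ^ K with hε
  have hε0 : 0 < ε := mul_pos hC₁0 (pow_pos hr₀pos K)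
  set Kb : ℝ := Q * D₀ * μL ^ (K + 1) + Q * D₀ * μL ^ K + ε with hKb
  have hQD : 0 ≤ Q * D₀ := mul_nonneg hQ0 hD₀0
  have hεKb : ε ≤ Kb := by
    have h1 := mul_nonneg hQD (pow_nonneg hμ0 (K + 1))
    have h2 := mul_nonneg hQD (pow_nonneg hμ0 K)
    rw [hKb]; linarith
  have hKbM : Kb ≤ M₂ * μL ^ K := by
    have hrK : r₀ ^ K ≤ μL ^ K := (pow_le_one₀ hr₀pos.le hr₀1).trans (one_le_pow₀ hμ1)
    have h1 : C₁ * r₀ ^ K ≤ C₁ * μL ^ K := mul_le_mul_of_nonneg_left hrK hC₁0.le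
    have h2 : Q * D₀ * μL ^ (K + 1) + Q * D₀ * μL ^ K + C₁ * r₀ ^ K ≤ (Q * D₀ * μL + Q * D₀ + C₁) * μL ^ K :=
      calc Q * D₀ * μL ^ (K + 1) + Q * D₀ * μL ^ K + C₁ * r₀ ^ K ≤ Q * D₀ * μL ^ (K + 1) + Q * D₀ * μL ^ K + C₁ * μL ^ K := by linarith
        _ = (Q * D₀ * μL + Q * D₀ + C₁) * μL ^ K := by rw [pow_succ]; ring
    rw [hKb, hM₂, hε]; exact h2
  have hK' : ∀ c, ∀ σ ∈ closedBall (0 : Fin 2 → ℂ) r₂, ‖gA c σ - gB c σ‖ ≤ Kb := fun c σ hσ => by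
    rw [mem_closedBall_zero_iff] at hσ
    have hA' : ‖gA c σ‖ ≤ Q * D₀ * μL ^ (K + 1) := by rw [hgA]; exact hsup (K + 1) c σ hσ
    have hB' : ‖gB c σ‖ ≤ Q * D₀ * μL ^ K := by rw [hgB]; exact hsup K c σ hσ
    rw [hKb]
    exact (norm_sub_le _ _).trans (by linarith)
  -- at REAL points the generating functions are the chart-free sums of (G≈ℝ) (chart clause)
  have hreal : ∀ (K' : ℕ) (c : ι) (a b : ℝ),
      (∑ X ∈ Finset.univ.filter (lo k K'), ((S K') k).E (histPrefix g k) (Φ K' k X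
          (((![(a : ℂ), (b : ℂ)] : Fin 2 → ℂ) 0) • ιc K' k X (Pi.single (Fin.cast (F.P_d K').symm μ) (Pi.single (siteOfInt F K' (k + 1) z) (bV c))) +
           ((![(a : ℂ), (b : ℂ)] : Fin 2 → ℂ) 1) • ιc K' k X (Pi.single (Fin.cast (F.P_d K').symm ν) (Pi.single (siteOfInt F K' (k + 1) 0) (bV c))))) X) =
      ∑ X ∈ Finset.univ.filter (lo k K'), ((S K') k).E (histPrefix g k) (emb K' k (fun l t => NormedSpace.exp (ρ
          ((a • (Pi.single (Fin.cast (F.P_d K').symm μ) (Pi.single (siteOfInt F K' (k + 1) z) (bV c)) : Fin (F.P K').d → Site (F.P K') (k + 1) → V) +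
            b • (Pi.single (Fin.cast (F.P_d K').symm ν) (Pi.single (siteOfInt F K' (k + 1) 0) (bV c)) : Fin (F.P K').d → Site (F.P K') (k + 1) → V)) l t)))) X := by
    intro K' c a b
    refine Finset.sum_congr rfl fun X _ => ?_
    rw [← hΦemb K' k X, map_add, map_smul, map_smul]
    simp only [Matrix.cons_val_zero, Matrix.cons_val_one, Complex.coe_smul]
  have hflat : ∀ c (a b : ℝ), |a| ≤ r₂ → |b| ≤ r₂ → ‖gA c ![(a : ℂ), (b : ℂ)] - gB c ![(a : ℂ), (b : ℂ)]‖ ≤ ε := fun c a b ha hb => by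
    have eqA := hreal (K + 1) c a b
    have eqB := hreal K c a b
    simp only [hgA, hgB]
    rw [eqA, eqB, hε]
    refine (hC K hK c a b ha hb).trans ?_
    exact mul_le_mul_of_nonneg_right (by rw [hC₁]; linarith [le_max_left C 0]) (pow_nonneg hr₀pos.le K)
  refine (abs_avg_polTensor_twoPoint_sub_le_of_realFlat gA gB hr₂ (by linarith) hε0 hεKb hs0 hs1 hgAhol hgBhol hK' hflat).trans ?_
  -- make it geometric
  have hρK := twoConstantsLetter_geometric (s := s) hC₁0.le hM₂0 hr₀pos.le hμ0 K
  have hmono := twoConstantsLetter_mono (s := s) hε0.le (le_refl ε) (hε0.le.trans hεKb) hKbM hs0.le hs1.le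
  rw [hε] at hmono
  rw [hρK] at hmono
  have hden : 0 < (r₂ * s / 4) ^ 2 := by positivity
  rw [div_mul_eq_mul_div, mul_assoc]
  exact div_le_div_of_nonneg_right (mul_le_mul_of_nonneg_left hmono (by norm_num)) hden.le

end Towers



/-! ## §4 The (1.21)-existence letter from the activity slots + the chart-free real-probe law (G≈ℝ): p607522 §1 with (S≈) ↦ (G≈ℝ) -/

section Existence

variable {𝔄 : Type*} [NormedRing 𝔄] [NormedAlgebra ℝ 𝔄] {𝔸 : Type*}
variable {V : Type*} [NormedAddCommGroup V] [NormedSpace ℝ V] {ι : Type*} [Fintype ι]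
variable (F : T4Family)

open Classical in
/-- ★★★ **THE (1.21)-EXISTENCE LETTER OF THE (1.7) LOCALIZED SUM FROM W1's ACTIVITY-LEVEL VALUE SLOT + THE CHART-FREE REAL-PROBE LAW (G≈ℝ).**  `polLimitsExist_localizedSum_of_activitySlots`
(p607522 §1) with its one structural law (S≈) REPLACED by (G≈ℝ) — geometric cross-volume closeness of the small-domain partial sums of the finite-volume (2.13) terms at the REAL probe
families `emb_K(exp ρ(a·e_{μ,z,c} + b·e_{ν,0,c}))`, `|a|, |b| ≤ r₂` (`0 < r₂`, `(2B₃+1)·2r₂ ≤ r`, rate `0 < r₀ ≤ 1`) — plus the dial `s ∈ ]0,1[` with the numeral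
`ρ_s = (r₀^{1−s}(L⁴)^{s})^{1−s}(L⁴)^{s} < 1`; §3 supplies (S≈) at the rate `ρ_s`, everything else is passed through.  Conclusion: W1-19b's `PolLimitsExist F (localizedSum F S emb) ρ bV W`.
[cite: Balaban1987RG1, (1.7) p.261, (1.20)-(1.21) p.264, p.282; Balaban1988RG2Cluster, (1.26) p.8, (2.13)-(2.14) pp.14-15, (2.38) p.20] -/
theorem polLimitsExist_localizedSum_of_realTwoPoint (m' : ℕ) (M : ℕ) [NeZero M] (hM : M = F.L ^ m')
    (S : (K : ℕ) → ClusterTower (F.P K) 𝔸 M) (emb : ReadingMaps F 𝔄 𝔸) (ρ : V →L[ℝ] 𝔄) (bV : Module.Basis ι ℝ V) (W : Set (ℕ → ℝ))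
    (Wk : (K k : ℕ) → Set (Fin (k + 1) → ℝ)) (hWk : ∀ g ∈ W, ∀ K k, histPrefix g k ∈ Wk K k)
    (sp : (K k : ℕ) → (domSys (F.P K) M (k + 1)).Dom → Set (CPair (F.P K) 𝔸)) {A R r₁ κ B₃ δ₀ r r₂ r₀ s : ℝ}
    (hA : 0 ≤ A) (hr₁ : 0 ≤ r₁) (hκ0 : 0 < κ) (hκ : κ ≤ r₁) (hκ4 : kappa₀ (4 * 2 ^ 4) (2 * 4) ≤ κ / 2 / 2) (hrate : r₁ + 2 * (64 * Real.log 162) + 2 ≤ R)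
    (hsmall : A * Real.exp (5 * r₁ + 1) * K₀ 64 8 * 9 * 64 ≤ 1) (hB₃ : 0 ≤ B₃) (hδ₀ : 0 < δ₀) (hr : 0 < r)
    (h238 : ∀ K k, ((S K) k).Bound238 (Wk K k) (sp K k) A R)
    (Ec : ℕ → ℕ → Type*) [∀ K k, NormedAddCommGroup (Ec K k)] [∀ K k, NormedSpace ℂ (Ec K k)]
    (ιc : (K k : ℕ) → (domSys (F.P K) M (k + 1)).Dom → ((Fin (F.P K).d → Site (F.P K) (k + 1) → V) →L[ℝ] Ec K k))
    (Φ : (K k : ℕ) → (domSys (F.P K) M (k + 1)).Dom → Ec K k → CPair (F.P K) 𝔸)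
    (U : (K k : ℕ) → (domSys (F.P K) M (k + 1)).Dom → Set (Ec K k)) (hU : ∀ K k X, IsOpen (U K k X)) (hrU : ∀ K k X, ball (0 : Ec K k) r ⊆ U K k X)
    (hHhol : ∀ K k, ∀ hist ∈ Wk K k, ∀ (X Z : (domSys (F.P K) M (k + 1)).Dom), Z.1 ⊆ X.1 →
      DifferentiableOn ℂ (fun z => ((S K) k).H hist (Φ K k X z) Z) (U K k X))
    (hΦemb : ∀ K k X (B : Fin (F.P K).d → Site (F.P K) (k + 1) → V), Φ K k X (ιc K k X B) = emb K k (fun l t => NormedSpace.exp (ρ (B l t))))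
    (hΦsp : ∀ K k X, ∀ z ∈ U K k X, ∀ Z : (domSys (F.P K) M (k + 1)).Dom, Z.1 ⊆ X.1 → Φ K k X z ∈ sp K k Z)
    (w : (K k : ℕ) → (domSys (F.P K) M (k + 1)).Dom → Site (F.P K) (k + 1) → ℝ) (hw₀ : ∀ K k X t, 0 ≤ w K k X t)
    (hw : ∀ K k X (l : Fin (F.P K).d) (t : Site (F.P K) (k + 1)) (c : ι), ‖ιc K k X (Pi.single l (Pi.single t (bV c)))‖ ≤ w K k X t)
    (hwB : ∀ K k (X : (domSys (F.P K) M (k + 1)).Dom) (t : Site (F.P K) (k + 1)),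
      w K k X t ≤ B₃ * Real.exp (-δ₀ * distCT (domCount (F.P K) M (k + 1)) M (fun i => (ZMod.cast (t i) : ZMod (domCount (F.P K) M (k + 1) * M)))
        (nearT (M := M) (fun i => (ZMod.cast (t i) : ZMod (domCount (F.P K) M (k + 1) * M))) X)))
    (lo : (k K : ℕ) → (domSys (F.P K) M (k + 1)).Dom → Prop) [∀ k K, DecidablePred (lo k K)]
    (hlo : ∀ (k K : ℕ) (X : (domSys (F.P K) M (k + 1)).Dom), ¬ lo k K X →
      let e : Site (F.P K) (k + 1) → TPt 4 (domCount (F.P K) M (k + 1) * M) := fun x i => (ZMod.cast (x i) : ZMod (domCount (F.P K) M (k + 1) * M))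
      (K : ℝ) ≤ torusTreeLen X.1 ∨ (K : ℝ) ≤ distCT (domCount (F.P K) M (k + 1)) M (e (siteOfInt F K (k + 1) 0)) (nearT (M := M) (e (siteOfInt F K (k + 1) 0)) X))
    (hr₂ : 0 < r₂) (hr₂r : (2 * B₃ + 1) * (2 * r₂) ≤ r) (hs0 : 0 < s) (hs1 : s < 1) (hr₀pos : 0 < r₀) (hr₀1 : r₀ ≤ 1)
    (hρ : (r₀ ^ (1 - s) * ((F.L : ℝ) ^ 4) ^ s) ^ (1 - s) * ((F.L : ℝ) ^ 4) ^ s < 1)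
    (hGR : ∀ g ∈ W, ∀ (k : ℕ) (μ ν : Fin 4) (z : Fin 4 → ℤ), ∃ (K₀ : ℕ) (C : ℝ), ∀ K : ℕ, K₀ ≤ K → ∀ (c : ι) (a b : ℝ), |a| ≤ r₂ → |b| ≤ r₂ →
      ‖∑ X ∈ Finset.univ.filter (lo k (K + 1)), ((S (K + 1)) k).E (histPrefix g k) (emb (K + 1) k (fun l t => NormedSpace.exp (ρ
          ((a • (Pi.single (Fin.cast (F.P_d (K + 1)).symm μ) (Pi.single (siteOfInt F (K + 1) (k + 1) z) (bV c)) : Fin (F.P (K + 1)).d → Site (F.P (K + 1)) (k + 1) → V) +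
            b • (Pi.single (Fin.cast (F.P_d (K + 1)).symm ν) (Pi.single (siteOfInt F (K + 1) (k + 1) 0) (bV c)) : Fin (F.P (K + 1)).d → Site (F.P (K + 1)) (k + 1) → V)) l t)))) X -
        ∑ X ∈ Finset.univ.filter (lo k K), ((S K) k).E (histPrefix g k) (emb K k (fun l t => NormedSpace.exp (ρ
          ((a • (Pi.single (Fin.cast (F.P_d K).symm μ) (Pi.single (siteOfInt F K (k + 1) z) (bV c)) : Fin (F.P K).d → Site (F.P K) (k + 1) → V) +
            b • (Pi.single (Fin.cast (F.P_d K).symm ν) (Pi.single (siteOfInt F K (k + 1) 0) (bV c)) : Fin (F.P K).d → Site (F.P K) (k + 1) → V)) l t)))) X‖ ≤ C * r₀ ^ K) :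
    PolLimitsExist F (localizedSum F S emb) ρ bV W :=
  have hρ0 : 0 ≤ (r₀ ^ (1 - s) * ((F.L : ℝ) ^ 4) ^ s) ^ (1 - s) * ((F.L : ℝ) ^ 4) ^ s :=
    mul_nonneg (Real.rpow_nonneg (mul_nonneg (Real.rpow_nonneg hr₀pos.le _) (Real.rpow_nonneg (pow_nonneg (Nat.cast_nonneg _) 4) _)) _)
      (Real.rpow_nonneg (pow_nonneg (Nat.cast_nonneg _) 4) _)
  polLimitsExist_localizedSum_of_activitySlots F m' M hM S emb ρ bV W Wk hWk sp hA hr₁ hκ0 hκ hκ4 hrate hsmall hB₃ hδ₀ hr h238 Ec ιc Φ U hU hrU hHhol hΦemb hΦsp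
    w hw₀ hw hwB lo hlo hρ hρ0
    (approxStable_of_realTwoPoint F M S emb ρ bV W Wk hWk sp hA hr₁ hκ0 hκ hκ4 hrate hsmall hB₃ hδ₀ hr h238 Ec ιc Φ U hU hrU hHhol hΦemb hΦsp w hw hwB lo
      hr₂ hr₂r hs0 hs1 hr₀pos hr₀1 hGR)

end Existence

end YMDAG.N22.AtKernels

end
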